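import Mathlib
import HarnessLib
import Literature.NumberTheory.GaloisRepresentations.ResidualGaloisRep
import Literature.NumberTheory.GaloisRepresentations.ProjectiveType
import Literature.NumberTheory.GaloisRepresentations.ProjectiveTypeSolvable
import Literature.Barriers.Langlands.SolvableImageBarrier
import Literature.RepresentationTheory.Semisimple.BurnsideMatrixSpan
import Literature.RepresentationTheory.Semisimple.FiniteFieldDescentAbsIrred

/-!
# The Klein layer of a tetrahedral-type image (helper for the row `(2, 3)` of crux
`CoreAdequacySplit.NoAdequateLayerLifting`, line `birth`, stub `stub_rung_rank2_ell3`)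

Def-free helper file (everything PROVED, Mathlib + the tree):

* `le_bot_of_commutator_eq_of_isSolvable` — a perfect subgroup of a solvable group is trivial;
* `exists_smul_eq_of_det_eq_zero`, `matrix_eq_of_mulVec_eq` — `2 × 2` linear algebra;
* `exists_klein_layer` — for `k` algebraically closed, `I ≤ GL₂(k)` finite, acting
  irreducibly, of tetrahedral type (`Ī ≅ A₄`): `I` is solvable, and the preimage `J ≤ I` of the
  Klein four-subgroup `V₄ ◁ A₄` acts absolutely irreducibly and is not of tetrahedral type (its
  projective image has order `≤ 4 < 12`).  Irreducibility of `J`: a common eigenvector `v` of `J`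
  and an `I`-translate `w = g v ∉ k v` diagonalise every `x ∈ J` (`J ◁ I`) as `(a, b)` with
  `a² = b²` (`x̄² = 1`); `b = a` means `x̄ = 1`, and all `x` with `b = -a` are proportional, so
  `V₄` would have at most two elements.  This is the layer "`O₂(G)·Z`" of Barnet-Lamb–Gee–
  Geraghty, Math. Ann. 2013, App. A, proof of Prop. A.2.1 (Point 9, the `PSL₂(𝔽₃)` case).

Used by `CoreAdequacySplitNoAdequateLayerLiftingStubRungRank2Ell3` (the stub, conditional on
BLGG 2013 App. A Prop. A.2.1).
-/

set_option linter.dupNamespace false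

open scoped MatrixGroups
open Filter
open scoped Matrix

namespace Summit.Langlands.Langlands.Theorems.CoreAdequacy.NoAdequateLayer

open Literature.NumberTheory.GaloisRepresentations

/-! ### Perfect subgroups of solvable groups; `A₄` is solvable -/

/-- **A perfect subgroup of a solvable group is trivial**: for `Q ≤ I ≤ GL_n(k)` with `I`
solvable and `⁅Q, Q⁆ = Q` one has `Q = ⊥` (Mathlib `IsSolvable.commutator_lt_of_ne_bot`, moved
inside `I` along `I.subtype`). [folklore] -/
theorem le_bot_of_commutator_eq_of_isSolvable {G : Type*} [Group G] (I : Subgroup G)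
    [IsSolvable I] (Q : Subgroup G) (hQI : Q ≤ I) (hQ : ⁅Q, Q⁆ = Q) : Q ≤ ⊥ := by
  rw [le_bot_iff]
  by_contra hne
  have hne' : Q.subgroupOf I ≠ ⊥ := by
    intro h0
    apply hne
    rw [← Subgroup.map_subgroupOf_eq_of_le hQI, h0, Subgroup.map_bot]
  have hlt := IsSolvable.commutator_lt_of_ne_bot hne'
  have hmap : (⁅Q.subgroupOf I, Q.subgroupOf I⁆).map I.subtype = (Q.subgroupOf I).map I.subtype := by
    rw [Subgroup.map_commutator, Subgroup.map_subgroupOf_eq_of_le hQI, hQ]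
  exact hlt.ne (Subgroup.map_injective I.subtype_injective hmap)

/-! ### The Klein layer of a tetrahedral-type image -/

/-- Two vectors `v, w ∈ k²` with `v ≠ 0` and `v₀ w₁ − v₁ w₀ = 0` are proportional. [folklore] -/
theorem exists_smul_eq_of_det_eq_zero {k : Type*} [Field k] {v w : Fin 2 → k} (hv : v ≠ 0)
    (h : v 0 * w 1 - v 1 * w 0 = 0) : ∃ a : k, w = a • v := by
  by_cases h0 : v 0 = 0
  · have h1 : v 1 ≠ 0 := by
      intro h1; apply hv; ext i; fin_cases i <;> simp [h0, h1]
    have hw0 : w 0 = 0 := by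
      rw [h0, zero_mul, zero_sub, neg_eq_zero] at h
      rcases mul_eq_zero.1 h with h' | h'
      · exact absurd h' h1
      · exact h'
    refine ⟨w 1 / v 1, ?_⟩
    ext i; fin_cases i
    · simp [h0, hw0]
    · simp [div_mul_cancel₀ _ h1]
  · refine ⟨w 0 / v 0, ?_⟩
    have e1 : w 1 = w 0 / v 0 * v 1 := by
      field_simp
      linear_combination h
    ext i; fin_cases i
    · simp [div_mul_cancel₀ _ h0]
    · simpa using e1

/-- Two `2 × 2` matrices agreeing on two linearly independent vectors are equal. [folklore] -/
theorem matrix_eq_of_mulVec_eq {k : Type*} [Field k] {M N : Matrix (Fin 2) (Fin 2) k}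
    {v w : Fin 2 → k} (hdet : v 0 * w 1 - v 1 * w 0 ≠ 0) (hv : M *ᵥ v = N *ᵥ v)
    (hw : M *ᵥ w = N *ᵥ w) : M = N := by
  set P : Matrix (Fin 2) (Fin 2) k := !![v 0, w 0; v 1, w 1] with hP
  have hPdet : P.det ≠ 0 := by
    rw [hP, Matrix.det_fin_two_of]
    intro h0; apply hdet; linear_combination h0
  have hMP : M * P = N * P := by
    ext i j
    fin_cases j
    · have := congr_fun hv i
      simpa [hP, Matrix.mul_apply, Matrix.mulVec, dotProduct, Fin.sum_univ_two] using this
    · have := congr_fun hw i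
      simpa [hP, Matrix.mul_apply, Matrix.mulVec, dotProduct, Fin.sum_univ_two] using this
  have hPu : IsUnit P := (Matrix.isUnit_iff_isUnit_det P).2 (isUnit_iff_ne_zero.2 hPdet)
  exact hPu.mul_left_injective hMP



/-- **The Klein layer of a tetrahedral-type image.**  Let `k` be algebraically closed,
`I ≤ GL₂(k)` finite acting irreducibly with projective image `Ī ≅ A₄`.  Then `I` is solvable (`Ī`
and the central kernel are; `A₄` is solvable, tree `alternatingGroup_four_isSolvable`), and the preimage `J ≤ I` of the Klein four-subgroup
`V₄ ◁ A₄` acts absolutely irreducibly and has projective image of order `4` (so not `≅ A₄`).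
Irreducibility of `J`: a common eigenvector `v` of `J` and an `I`-translate `w = g v ∉ k v`
(irreducibility of `I`) diagonalise every `x ∈ J` (`J ◁ I`) as `(a, b)` with `a² = b²` (`x̄² = 1`,
so `x²` is scalar); `b = a` means `x̄ = 1`, and all `x` with `b = -a` are proportional, so `V₄`
would have at most two elements (in characteristic `2` even at most one).  This is the layer used in Barnet-Lamb–Gee–Geraghty's treatment
of the `PSL₂(𝔽₃)` case (App. A, proof of Prop. A.2.1, Point 9: "`O₂(G)·Z`"). [folklore] -/
theorem exists_klein_layer {k : Type*} [Field k] [IsAlgClosed k]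
    (I : Subgroup (GL (Fin 2) k)) [Finite I]
    (hirr : (glRepresentation I.subtype).IsIrreducible) (hT : IsTetrahedralType I.subtype) :
    IsSolvable I ∧ ∃ J : Subgroup (GL (Fin 2) k), J ≤ I ∧ IsAbsIrreducible J.subtype ∧
      (glRepresentation J.subtype).IsIrreducible ∧ ¬ IsTetrahedralType J.subtype := by
  classical
  obtain ⟨e⟩ := hT
  have h4 : Nat.card (Fin 4) = 4 := by simp
  -- `V₄ ◁ A₄`, transported to the projective image `Ī`
  set K : Subgroup (alternatingGroup (Fin 4)) := alternatingGroup.kleinFour (Fin 4) with hK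
  have hKn : K.Normal := alternatingGroup.normal_kleinFour h4
  have hKc : Nat.card K = 4 := alternatingGroup.kleinFour_card_of_card_eq_four h4
  have hKe : ∀ x : K, x * x = 1 := fun x => by
    have hx := Monoid.pow_exponent_eq_one x
    rwa [alternatingGroup.exponent_kleinFour_of_card_eq_four h4, pow_two] at hx
  set V : Subgroup (projectiveImage I.subtype) := K.map e.symm.toMonoidHom with hV
  have hVn : V.Normal := hKn.map e.symm.toMonoidHom e.symm.surjective
  have hVc : Nat.card V = 4 := by
    rw [hV, Subgroup.card_map_of_injective e.symm.injective, hKc]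
  have hVe : ∀ x ∈ V, x * x = 1 := by
    rintro _ ⟨y, hy, rfl⟩
    have hyy : (y : alternatingGroup (Fin 4)) * y = 1 := by
      have := congrArg Subtype.val (hKe ⟨y, hy⟩)
      simpa using this
    rw [← map_mul, hyy, map_one]
  -- the projection `I → Ī` and the layer `J`
  set πI : I →* projectiveImage I.subtype :=
    (Matrix.ProjGenLinGroup.mk.comp I.subtype).rangeRestrict with hπI
  have hπI_surj : Function.Surjective πI := MonoidHom.rangeRestrict_surjective _
  have hπI_coe : ∀ x : I, ((πI x : projectiveImage I.subtype) : PGL(Fin 2, k)) =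
      Matrix.ProjGenLinGroup.mk (x : GL (Fin 2) k) := fun x => rfl
  set J₀ : Subgroup I := V.comap πI with hJ₀
  have hJ₀n : J₀.Normal := hVn.comap πI
  set J : Subgroup (GL (Fin 2) k) := J₀.map I.subtype with hJ
  have hJI : J ≤ I := Subgroup.map_subtype_le J₀
  -- solvability of `I`
  haveI : IsSolvable (alternatingGroup (Fin 4)) :=
    Literature.Barriers.Langlands.alternatingGroup_four_isSolvable
  have hsolvP : IsSolvable (projectiveImage I.subtype) :=
    solvable_of_solvable_injective (f := e.toMonoidHom) e.injective
  haveI hsolvR : IsSolvable I.subtype.range := (isSolvable_projectiveImage_iff I.subtype).1 hsolvP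
  have hsolvI : IsSolvable I :=
    solvable_of_solvable_injective (f := Subgroup.inclusion (Subgroup.range_subtype I).symm.le)
      (Subgroup.inclusion_injective _)
  refine ⟨hsolvI, J, hJI, ?_⟩
  -- squares of elements of `J₀` are scalar
  have hsq : ∀ x : I, x ∈ J₀ → ∃ c : k, (((x : GL (Fin 2) k)) : Matrix (Fin 2) (Fin 2) k) *
      (((x : GL (Fin 2) k)) : Matrix (Fin 2) (Fin 2) k) = c • (1 : Matrix (Fin 2) (Fin 2) k) := by
    intro x hx
    have hx' : πI x ∈ V := hx
    have h1 := congrArg Subtype.val (hVe _ hx')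
    rw [Subgroup.coe_mul, Subgroup.coe_one, hπI_coe, ← map_mul, Matrix.ProjGenLinGroup.mk_eq_one,
      GL2.mem_center_iff] at h1
    obtain ⟨h01, h10, h00⟩ := h1
    refine ⟨((((x : GL (Fin 2) k)) * ((x : GL (Fin 2) k)) : GL (Fin 2) k) :
      Matrix (Fin 2) (Fin 2) k) 1 1, ?_⟩
    rw [← Units.val_mul]
    ext i j
    fin_cases i <;> fin_cases j <;> simp [h01, h10, h00]
  -- `J` has no common eigenvector
  have hnce : ∀ v : Fin 2 → k, v ≠ 0 →
      ∃ g : J, (((J.subtype g : GL (Fin 2) k)) : Matrix (Fin 2) (Fin 2) k) *ᵥ v ∉ k ∙ v := by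
    intro v hv0
    by_contra hall
    push Not at hall
    -- eigenvalue on `v` of every `x ∈ J₀`
    have hev : ∀ x : I, x ∈ J₀ →
        ∃ a : k, (((x : GL (Fin 2) k)) : Matrix (Fin 2) (Fin 2) k) *ᵥ v = a • v := by
      intro x hx
      have hxJ : ((x : GL (Fin 2) k)) ∈ J := Subgroup.mem_map.2 ⟨x, hx, rfl⟩
      have hm := hall ⟨(x : GL (Fin 2) k), hxJ⟩
      simp only [Subgroup.coe_subtype] at hm
      obtain ⟨a, ha⟩ := Submodule.mem_span_singleton.1 hm
      exact ⟨a, ha.symm⟩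
    -- an element of `I` moving the line `k v` (irreducibility of `I`)
    have hI : ¬ HasCommonEigenvector I.subtype :=
      not_hasCommonEigenvector_of_isIrreducible I.subtype hirr
    obtain ⟨g, hg⟩ : ∃ g : I, ∀ a : k,
        (((g : GL (Fin 2) k)) : Matrix (Fin 2) (Fin 2) k) *ᵥ v ≠ a • v := by
      by_contra hcon
      push Not at hcon
      exact hI ⟨v, hv0, fun g => hcon g⟩
    set w : Fin 2 → k := (((g : GL (Fin 2) k)) : Matrix (Fin 2) (Fin 2) k) *ᵥ v with hw
    have hdet : v 0 * w 1 - v 1 * w 0 ≠ 0 := by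
      intro h0
      obtain ⟨a, ha⟩ := exists_smul_eq_of_det_eq_zero hv0 h0
      exact hg a ha
    have hw0 : w ≠ 0 := by
      intro h0
      apply hdet
      rw [h0]
      simp
    -- eigenvalue on `w`, by normality of `J₀` in `I`
    have hew : ∀ x : I, x ∈ J₀ →
        ∃ b : k, (((x : GL (Fin 2) k)) : Matrix (Fin 2) (Fin 2) k) *ᵥ w = b • w := by
      intro x hx
      have hx' : g⁻¹ * x * g⁻¹⁻¹ ∈ J₀ := hJ₀n.conj_mem x hx g⁻¹
      rw [inv_inv] at hx'
      obtain ⟨b, hb⟩ := hev _ hx'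
      refine ⟨b, ?_⟩
      have e0 : (g : GL (Fin 2) k) * ((g⁻¹ * x * g : I) : GL (Fin 2) k) =
          (x : GL (Fin 2) k) * (g : GL (Fin 2) k) := by
        rw [Subgroup.coe_mul, Subgroup.coe_mul, Subgroup.coe_inv, mul_assoc, mul_inv_cancel_left]
      have e1 := congrArg (fun u : GL (Fin 2) k => (u : Matrix (Fin 2) (Fin 2) k)) e0
      simp only [Units.val_mul] at e1
      rw [hw, Matrix.mulVec_mulVec, ← e1, ← Matrix.mulVec_mulVec, hb, Matrix.mulVec_smul]
    -- each `x ∈ J₀` acts by `(a, ±a)` on `(v, w)`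
    have hab : ∀ x : I, x ∈ J₀ → ∃ a : k, a ≠ 0 ∧
        (((x : GL (Fin 2) k)) : Matrix (Fin 2) (Fin 2) k) *ᵥ v = a • v ∧
        ((((x : GL (Fin 2) k)) : Matrix (Fin 2) (Fin 2) k) *ᵥ w = a • w ∨
          (((x : GL (Fin 2) k)) : Matrix (Fin 2) (Fin 2) k) *ᵥ w = -(a • w)) := by
      intro x hx
      obtain ⟨a, ha⟩ := hev x hx
      obtain ⟨b, hb⟩ := hew x hx
      obtain ⟨c, hc⟩ := hsq x hx
      have hsq2 : ∀ (u : Fin 2 → k) (t : k), u ≠ 0 →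
          (((x : GL (Fin 2) k)) : Matrix (Fin 2) (Fin 2) k) *ᵥ u = t • u → t * t = c := by
        intro u t hu0 hu
        have e : ((((x : GL (Fin 2) k)) : Matrix (Fin 2) (Fin 2) k) *
            (((x : GL (Fin 2) k)) : Matrix (Fin 2) (Fin 2) k)) *ᵥ u =
            (c • (1 : Matrix (Fin 2) (Fin 2) k)) *ᵥ u := by rw [hc]
        rw [← Matrix.mulVec_mulVec, hu, Matrix.mulVec_smul, hu, smul_smul,
          Matrix.smul_mulVec, Matrix.one_mulVec] at e
        have e' : (t * t - c) • u = 0 := by rw [sub_smul, e, sub_self]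
        rcases smul_eq_zero.1 e' with h | h
        · exact sub_eq_zero.1 h
        · exact absurd h hu0
      have ha2 := hsq2 v a hv0 ha
      have hb2 := hsq2 w b hw0 hb
      have ha0 : a ≠ 0 := by
        rintro rfl
        apply hv0
        have e := congrArg
          (fun u => ((((x : GL (Fin 2) k))⁻¹ : GL (Fin 2) k) : Matrix (Fin 2) (Fin 2) k) *ᵥ u) ha
        simp only [zero_smul, Matrix.mulVec_zero, Matrix.mulVec_mulVec, ← Units.val_mul,
          inv_mul_cancel, Units.val_one, Matrix.one_mulVec] at e
        exact e
      refine ⟨a, ha0, ha, ?_⟩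
      have hfac : (b - a) * (b + a) = 0 := by
        have : b * b - a * a = 0 := by rw [hb2, ha2, sub_self]
        linear_combination this
      rcases mul_eq_zero.1 hfac with h | h
      · left
        rw [hb, sub_eq_zero.1 h]
      · right
        rw [hb, eq_neg_of_add_eq_zero_left h, neg_smul]
    -- two elements of `J₀` with non-trivial class have the same class
    have hcls : ∀ x : I, x ∈ J₀ → ∀ y : I, y ∈ J₀ →
        Matrix.ProjGenLinGroup.mk (x : GL (Fin 2) k) ≠ 1 →
        Matrix.ProjGenLinGroup.mk (y : GL (Fin 2) k) ≠ 1 →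
        Matrix.ProjGenLinGroup.mk (x : GL (Fin 2) k) =
          Matrix.ProjGenLinGroup.mk (y : GL (Fin 2) k) := by
      intro x hx y hy hx1 hy1
      obtain ⟨a, ha0, hav, haw⟩ := hab x hx
      obtain ⟨b, hb0, hbv, hbw⟩ := hab y hy
      -- the sign `+` would make the class trivial
      have hneg : ∀ (z : I) (t : k),
          (((z : GL (Fin 2) k)) : Matrix (Fin 2) (Fin 2) k) *ᵥ v = t • v →
          (((z : GL (Fin 2) k)) : Matrix (Fin 2) (Fin 2) k) *ᵥ w = t • w →
          Matrix.ProjGenLinGroup.mk (z : GL (Fin 2) k) = 1 := by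
        intro z t hzv hzw
        have hz : (((z : GL (Fin 2) k)) : Matrix (Fin 2) (Fin 2) k) =
            t • (1 : Matrix (Fin 2) (Fin 2) k) :=
          matrix_eq_of_mulVec_eq hdet (by rw [hzv, Matrix.smul_mulVec, Matrix.one_mulVec])
            (by rw [hzw, Matrix.smul_mulVec, Matrix.one_mulVec])
        rw [Matrix.ProjGenLinGroup.mk_eq_one, GL2.mem_center_iff, hz]
        simp
      have hxw : (((x : GL (Fin 2) k)) : Matrix (Fin 2) (Fin 2) k) *ᵥ w = -(a • w) := by
        rcases haw with h | h
        · exact absurd (hneg x a hav h) hx1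
        · exact h
      have hyw : (((y : GL (Fin 2) k)) : Matrix (Fin 2) (Fin 2) k) *ᵥ w = -(b • w) := by
        rcases hbw with h | h
        · exact absurd (hneg y b hbv h) hy1
        · exact h
      -- `b • x = a • y` on the basis `(v, w)`
      have hxy : b • (((x : GL (Fin 2) k)) : Matrix (Fin 2) (Fin 2) k) =
          a • (((y : GL (Fin 2) k)) : Matrix (Fin 2) (Fin 2) k) :=
        matrix_eq_of_mulVec_eq hdet
          (by rw [Matrix.smul_mulVec, Matrix.smul_mulVec, hav, hbv, smul_smul,
            smul_smul, mul_comm])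
          (by rw [Matrix.smul_mulVec, Matrix.smul_mulVec, hxw, hyw, smul_neg,
            smul_neg, smul_smul, smul_smul, mul_comm])
      rw [GL2.mk_eq_mk_iff_smul]
      refine ⟨Units.mk0 (b / a) (div_ne_zero hb0 ha0), ?_⟩
      rw [Units.val_mk0, div_eq_inv_mul, mul_smul, hxy, smul_smul, inv_mul_cancel₀ ha0, one_smul]
    -- hence `V` has at most two elements — but it has four
    have hV2 : Nat.card V ≤ 2 := by
      have hf : Function.Injective
          (fun x : V => decide ((x : projectiveImage I.subtype) = 1)) := by
        intro x y hxy
        dsimp only at hxy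
        obtain ⟨x0, hx0⟩ := hπI_surj (x : projectiveImage I.subtype)
        obtain ⟨y0, hy0⟩ := hπI_surj (y : projectiveImage I.subtype)
        have hx0J : x0 ∈ J₀ := by
          change πI x0 ∈ V
          rw [hx0]
          exact x.2
        have hy0J : y0 ∈ J₀ := by
          change πI y0 ∈ V
          rw [hy0]
          exact y.2
        by_cases hx1 : (x : projectiveImage I.subtype) = 1
        · by_cases hy1 : (y : projectiveImage I.subtype) = 1
          · exact Subtype.ext (hx1.trans hy1.symm)
          · exact absurd hxy (by simp [hx1, hy1])
        · by_cases hy1 : (y : projectiveImage I.subtype) = 1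
          · exact absurd hxy (by simp [hx1, hy1])
          · have hx1' : Matrix.ProjGenLinGroup.mk (x0 : GL (Fin 2) k) ≠ 1 := by
              intro h
              apply hx1
              rw [← hx0]
              exact Subtype.ext (by rw [hπI_coe, h]; rfl)
            have hy1' : Matrix.ProjGenLinGroup.mk (y0 : GL (Fin 2) k) ≠ 1 := by
              intro h
              apply hy1
              rw [← hy0]
              exact Subtype.ext (by rw [hπI_coe, h]; rfl)
            have hc := hcls x0 hx0J y0 hy0J hx1' hy1'
            apply Subtype.ext
            rw [← hx0, ← hy0]
            exact Subtype.ext (by rw [hπI_coe, hπI_coe, hc])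
      have hle := Nat.card_le_card_of_injective _ hf
      simpa using hle
    omega
  -- Burnside: no common eigenvector over `k = k̄` ⇒ the matrices of `J` span `M₂(k)`
  have hspan :=
    Literature.RepresentationTheory.Semisimple.span_eq_top_of_no_common_eigenvector J.subtype hnce
  refine ⟨(Literature.RepresentationTheory.Semisimple.span_eq_top_iff_forall_isIrreducible
      two_pos J.subtype).1 hspan,
    Literature.RepresentationTheory.Semisimple.isIrreducible_of_span_eq_top two_pos J.subtype hspan,
    ?_⟩
  -- not tetrahedral: the projective image of `J` lies in `V`, of order `4 ≠ 12`
  rintro ⟨f⟩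
  haveI : Finite (projectiveImage I.subtype) := by
    unfold projectiveImage
    exact finite_range_of_finite _
  -- `V ↠ J̄`, `v ↦ v`
  have hmemJ : ∀ x : V, ((x : projectiveImage I.subtype) : PGL(Fin 2, k)) ∈
      projectiveImage J.subtype := by
    intro x
    obtain ⟨x0, hx0⟩ := hπI_surj (x : projectiveImage I.subtype)
    have hx0J : x0 ∈ J₀ := by
      change πI x0 ∈ V
      rw [hx0]
      exact x.2
    refine ⟨⟨(x0 : GL (Fin 2) k), Subgroup.mem_map.2 ⟨x0, hx0J, rfl⟩⟩, ?_⟩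
    rw [← hx0]
    rfl
  have hsurjV : Function.Surjective
      (fun x : V => (⟨_, hmemJ x⟩ : projectiveImage J.subtype)) := by
    rintro ⟨_, j, rfl⟩
    obtain ⟨x, hx, hxj⟩ := Subgroup.mem_map.1 j.2
    refine ⟨⟨πI x, hx⟩, Subtype.ext ?_⟩
    change Matrix.ProjGenLinGroup.mk ((x : GL (Fin 2) k)) =
      Matrix.ProjGenLinGroup.mk ((j : GL (Fin 2) k))
    rw [← hxj]
    rfl
  have hcard : Nat.card (projectiveImage J.subtype) ≤ 4 := by
    have hle := Nat.card_le_card_of_surjective _ hsurjV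
    rwa [hVc] at hle
  have h12 : Nat.card (projectiveImage J.subtype) = 12 := by
    rw [Nat.card_congr f.toEquiv, alternatingGroup.card_of_card_eq_four h4]
  omega

end Summit.Langlands.Langlands.Theorems.CoreAdequacy.NoAdequateLayer
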